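import Summits.NavierStokesRegularity.FluidComputer.RowPhaseChain
import HarnessLib

/-!
# The k53d chain: THE CERTIFIED ENCLOSURES HOLD FOR EVERY ADMISSIBLE TRAJECTORY (layers A + A′;
# `pub-fluidc-bp3/R1-DESIGN.md` §11)

HONEST FRAMING (cell `pub-fluidc`, blueprint seat bp3, gen 22): low prior, high value-of-information
experiment on Tao's machine paradigm; NOT a claim that NS blows up.

WHAT. The top statement of the row-model chain below layer R: `RowChain.enclosure` = `chain_members`
(layer A′: the phase maps exist) fed into `segAD` (layer A: the certified tables are sound for
members). For ONE trajectory `y` of the circuit field with defect `δF` on an open maximal domain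
`D` — hypotheses: the ODE with defect, per-row continuity of the phase speed and TUBE defect class,
the maximal-domain property, the WINDOW hypotheses at the two stage switches, and the start data
(`σ₀ ∈ D`, lock `y_1(σ₀) = x̂_1(0)`, start box `u₀`) — there EXIST phase maps (one per lock
coordinate: rows `0–656`, `657–986`, `987–1065`) under which, on every one of the 1066 rows, the
re-timed trajectory starts each row in the row's start box, stays within `Ē` of the reference and
within `W̄` in frame coordinates, and runs at phase rate within `ρ` of `1`. What remains ABOVE this
file is layer R only: discharge the five phase-independent hypotheses and the two window hypotheses
for the trajectories of interest (defect construction, blow-up alternative, defect replay).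

[cite: Tao2016AveragedNS, §5.5 Thm 5.3 (5.5)]
-/

namespace Summit.NavierStokesRegularity.FluidComputer

open Literature.Analysis.FluidPDE.FluidComputer

namespace RowChain

open RowCheck RowCheck.RowData RowRun ChainField Set

/-- **Layers A + A′: the certified enclosures of the k53d chain hold, after a re-timing that
exists, for every trajectory satisfying layer R's phase-independent hypotheses.** [folklore] -/
theorem enclosure (T : ℕ → ℝ) (hT : ∀ k, T (k + 1) = T k + (row k).Hq)
    {y δF : ℝ → Fin 9 → ℝ} {D : Set ℝ} (hDo : IsOpen D)
    (hy : ∀ σ ∈ D, ∀ a, HasDerivAt (fun τ => y τ a) (F gK ΛK (y σ) a + δF σ a) σ)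
    (hFc : ∀ k < 1066, ContinuousOn (fun σ => F gK ΛK (y σ) (row k).p + δF σ (row k).p) D)
    (htube : ∀ k < 1066, ∀ σ ∈ D, ∀ t ∈ Icc (T k) (T (k + 1)),
      (∀ a, |y σ a - xh (row k).CQ (t - T k) a| ≤ (row k).EbarR a) →
        ∀ a, |δF σ a| ≤ (row k).δR a)
    (hDmax : ∀ K ⊆ D, (∀ a, ∃ C, ∀ σ ∈ K, |y σ a| ≤ C) → closure K ⊆ D)
    (hW1 : ∀ σ ∈ D, (∀ a, |y σ a - (row 657).X0R a| ≤ ((row 656).Eb a : ℝ) / 2 ^ (row 657).P) →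
      Icc (σ - (cert656.Ds : ℝ) / 2 ^ (row 657).P) (σ + (cert656.Ds : ℝ) / 2 ^ (row 657).P) ⊆ D ∧
      ∀ ξ ∈ Icc (σ - (cert656.Ds : ℝ) / 2 ^ (row 657).P) (σ + (cert656.Ds : ℝ) / 2 ^ (row 657).P),
        ∀ a, |δF ξ a| ≤ ((max ((row 656).DEL a) ((row 657).DEL a) : ℤ) : ℝ) / 2 ^ (row 657).P)
    (hW2 : ∀ σ ∈ D, (∀ a, |y σ a - (row 987).X0R a| ≤ ((row 986).Eb a : ℝ) / 2 ^ (row 987).P) →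
      Icc (σ - (cert986.Ds : ℝ) / 2 ^ (row 987).P) (σ + (cert986.Ds : ℝ) / 2 ^ (row 987).P) ⊆ D ∧
      ∀ ξ ∈ Icc (σ - (cert986.Ds : ℝ) / 2 ^ (row 987).P) (σ + (cert986.Ds : ℝ) / 2 ^ (row 987).P),
        ∀ a, |δF ξ a| ≤ ((max ((row 986).DEL a) ((row 987).DEL a) : ℤ) : ℝ) / 2 ^ (row 987).P)
    {σ₀ : ℝ} (hσ₀ : σ₀ ∈ D) (hlock0 : y σ₀ (row 0).p = xh (row 0).CQ 0 (row 0).p)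
    (hu0 : ∀ i, |(toModel (canon (framesOK_row 0)) (G 0) (T 0)
      ⟨y, δF, D, fun _ => σ₀, fun _ => 0⟩).z (T 0) i| ≤ (row 0).ubR 0 i) :
    ∃ sA sdA sB sdB sD sdD : ℝ → ℝ, sA (T 0) = σ₀ ∧ ∀ k < 1066,
      (∀ i, |(toModel (canon (framesOK_row k)) (G k) (T k)
        (mOf ⟨y, δF, D, sA, sdA⟩ ⟨y, δF, D, sB, sdB⟩ ⟨y, δF, D, sD, sdD⟩ k)).z (T k) i| ≤
          (row k).ubR 0 i) ∧
      (∀ t ∈ Icc (T k) (T (k + 1)), ∀ a, |(toModel (canon (framesOK_row k)) (G k) (T k)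
        (mOf ⟨y, δF, D, sA, sdA⟩ ⟨y, δF, D, sB, sdB⟩ ⟨y, δF, D, sD, sdD⟩ k)).e t a| ≤
          (row k).EbarR a) ∧
      (∀ t ∈ Icc (T k) (T (k + 1)), ∀ i, |(toModel (canon (framesOK_row k)) (G k) (T k)
        (mOf ⟨y, δF, D, sA, sdA⟩ ⟨y, δF, D, sB, sdB⟩ ⟨y, δF, D, sD, sdD⟩ k)).z t i| ≤
          (row k).WbarR i) ∧
      (∀ t ∈ Ico (T k) (T (k + 1)),
        |(mOf ⟨y, δF, D, sA, sdA⟩ ⟨y, δF, D, sB, sdB⟩ ⟨y, δF, D, sD, sdD⟩ k).sd t - 1| ≤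
          (row k).rhoR) := by
  obtain ⟨sA, sdA, sB, sdB, sD, sdD, hsA0, hmem, ⟨S1⟩, ⟨S2⟩⟩ := chain_members T hT hDo hy hFc htube
    hDmax hW1 hW2 hσ₀ hlock0 hu0
  have hu0A : ∀ i, |(toModel (canon (framesOK_row 0)) (G 0) (T 0) ⟨y, δF, D, sA, sdA⟩).z (T 0) i|
      ≤ (row 0).ubR 0 i := by
    intro i
    rw [z_start_eq _ _ _ y δF D (s' := fun _ => σ₀) (sd' := fun _ => 0) hsA0]
    exact hu0 i
  refine ⟨sA, sdA, sB, sdB, sD, sdD, hsA0, ?_⟩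
  have h := segAD T hT ⟨y, δF, D, sA, sdA⟩ ⟨y, δF, D, sB, sdB⟩ ⟨y, δF, D, sD, sdD⟩
    (fun k hk => (hmem k hk).some) hu0A S1 S2
  exact h

end RowChain

end Summit.NavierStokesRegularity.FluidComputer
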